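import Literature.Probability.FitznerVanDerHofstad2017.NobleKSpaceRewriteFRem
import HarnessLib

/-!
# [NoBLE17] Prop. 4.5(ii) → the two oracle binders of the bootstrap, with App. D in the kernel — module 3c-C:
the improvement-step and initial-step inputs, and mean-field behaviour from a certificate, WITHOUT the
Prop. 4.5(ii) leaf

Fitzner–van der Hofstad, *Generalized approach to the non-backtracking lace expansion*, Probab. Theory
Relat. Fields **169** (2017) 1041–1119 (= arXiv:1506.07969, "NoBLE17"): Prop. 4.5(ii) (p. 1088), Appendix D
(D.1)–(D.32) (pp. 1110–1117), Assumption 4.3 and its closing sentence (pp. 1086–1088), Def. 2.9 / Thm 2.10 /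
Prop. 2.11 (pp. 1060–1062); Fitzner–van der Hofstad, *Mean-field behavior for nearest-neighbor percolation in
`d > 10`*, Electron. J. Probab. **22** (2017) no. 43 (= arXiv:1506.07977, "FvdH17"): Prop. 2.1 (NoBLE equations),
Prop. 2.2 (diagrammatic bounds), §2.4–§2.5 (the bootstrap run).

CONTEXT.  The bootstrap theorems of the tree (`nobleBootstrapBound_of_certificate`, `meanField_of_certificate`,
module `NobleInstantiate`) take two ORACLE BINDERS: `NobleInitialInputsAt d Bi bi` (the simplified NoBLE form
(Assumption 2.7) at `p_I = 1/(2d−1)` with constants `Bi`, plus the weighted-diagram bounds `bi`) and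
`NobleImprovementInputsAt d cμ c Γ Bo bo` (the same at every `p ∈ (p_I, p_c)` with `f(p) ≤ Γ`).  So far these were
obtained from the Prop. 4.5(ii) LEAF — the hybrid `FitznerVanDerHofstad2016NoBLE_prop45ii d` (not citable, not
proved; `nobleImprovementInputsAt_of_prop45ii`, `nobleInitialInputsAt_of_prop45ii`) — i.e. from [NoBLE17] App. D
taken as a hypothesis.  Modules 1, 2, 3a, 3b, 3c-A, 3c-B of this line (`NobleKSpaceRewrite`, `…Phi`, `…F`,
`NobleCosineSplit`, `NobleWeightedConvolution`, `NobleKSpaceRewriteFRem`) PROVE App. D in the kernel for the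
percolation split: `nobleSimplifiedFormAt_percolation₅`.

THIS MODULE (pure logic over those theorems; no new definition, no numeral, no named fact):
* `nobleSimplifiedFormAt_percolation₆` — Prop. 4.5(ii) for percolation with the NoBLE-equation hypothesis ALSO
  discharged (`percolationNobleEquationAt_of_summable`: the `N`-summabilities are read off the `NSumLE` clauses of
  Assumption 4.3): hypotheses = `0 < p < p_c`, a well-formed record `i` (`NobleInputsWF`), Assumption 4.3 at `p`
  for the percolation split with constants `i`, and the four decidable sign conditions (N1′) `0 ≤ c̲_Φ(i)`, (N2)
  `β^abs_Ξ + β^abs_{Ξ^ι} < 1`, (N3) `β_Ψ(i) < 1`, (N4) `0 ≤ α̲_F(i)`; conclusion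
  `NobleSimplifiedFormAt d p (nobleBetaOfInputsCorr d i)`.
* `nobleImprovementInputsAt_of_assumption43` / `nobleInitialInputsAt_of_assumption43` — the two oracle binders at
  the table `nobleBetaOfInputsCorr d i`, from Assumption 4.3 (improvement stage: at every `p ∈ (p_I, p_c)` with
  `f(p) ≤ Γ`; initial stage: at `p_I`, [NoBLE17] Assumption 4.3 closing sentence) and the weighted-diagram bounds
  ([FvdH17] Prop. 2.2) — NO Prop. 4.5(ii) / App. D hypothesis.
* `meanField_of_certificate_assumption43` — [NoBLE17] Thm 2.10 / Prop. 2.11 as wired in `meanField_of_certificate`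
  (`d ≥ 7`): a numeric certificate `NobleNumericCertificate d cμ c γ Γ (nobleBetaOfInputsCorr d iI)
  (nobleBetaOfInputsCorr d iO) bi bo` + the Assumption-4.3 / weighted-diagram inputs at both stages + the
  well-formedness and sign conditions of `iI`, `iO` ⟹ `TriangleCondition d ∧ PercolationContinuity d ∧
  BetaEqOneBoundedRatio d`.

HONEST LABEL (ABSOLUTE RULE; REFEREE V1(b)).  Nothing is cited as a fact and no hypothesis is hidden: what REMAINS
on this line is typed and visible — (S2a) Assumption 4.3 of [NoBLE17] at the percolation split with the record's
constants ([FvdH17] §§4–6, the `x`-space diagrammatic bounds: ANALYTIC, not proved here), (S2b) the weighted-diagram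
bounds ([FvdH17] Prop. 2.2), the numeric certificate and the decidable conditions on the records (arithmetic at a
table).  The β-table is `nobleBetaOfInputsCorr d i` — the generated `nobleBetaOfInputs d i` with the `βΔ` slot
carrying the Step-4/5 bookkeeping constant `betaRfDeltaCorr` (programme divergence note D65, HOME/DIVERGENCE.md;
all other slots agree by `rfl`); evaluating a certificate at that table is the consumers' business (at a literal
record: exact arithmetic), not this file's.  `NobleInstantiate`, `NobleAssumptions`, the generated `BetaMap` and every
certificate module are untouched; nothing here is specific to a dimension.
-/

noncomputable section

namespace Literature.Probability.FitznerVanDerHofstad2017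

open _root_.MeasureTheory _root_.Filter _root_.Topology Literature.Probability.LatticeModels
open Literature.Barriers.CriticalPhenomena Literature.Probability.Percolation
open scoped BigOperators

variable {d : ℕ}

/-! ## 1. Prop. 4.5(ii) for percolation, NoBLE equation discharged -/

/-- **[NoBLE17] Prop. 4.5(ii) for percolation, every App. D constant constructed, the NoBLE equations a theorem.**
For `d ≥ 2`, `0 < p < p_c`, a well-formed record `i`, Assumption 4.3 at `p` for the percolation split of [FvdH17] §3
with constants `i`, and the decidable sign conditions (N1′), (N2), (N3), (N4): the simplified NoBLE form
(Assumption 2.7 with the Lemma 3.1 data) holds at `p` with the table `nobleBetaOfInputsCorr d i`.  The NoBLE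
equations (1.24)–(1.25) at `p` are the theorem `percolationNobleEquationAt_of_summable`, whose `N`-summability inputs
are the `NSumLE` clauses `xiAbs`, `xiIotaAbs` of Assumption 4.3.
[cite: FitznerVanDerHofstad2016NoBLE, Prop. 4.5(ii) (p. 1088); App. D (D.1)–(D.32) (pp. 1110–1117); Assumption 4.3 (4.30)–(4.33) (p. 1086)]
[cite: FitznerVanDerHofstad2017, Prop. 2.1 (EJP p. 10); §3.5] -/
theorem nobleSimplifiedFormAt_percolation₆ (hd : 2 ≤ d) {p : unitInterval} (hp : p < criticalProbI d)
    (hp0 : 0 < (p : ℝ)) {i : BetaMap.Inputs} (hWF : NobleInputsWF d i)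
    (h43 : NobleAssumption43At d p (percolationNobleSplit d p hd hp) i)
    (hN1 : 0 ≤ BetaMap.betaCPhiLow d i.mu i.xiAlphaOneMinusZeroAtZero i.xiIotaAlphaIAtEi)
    (hN2 : i.xiAbs + i.xiIotaAbs < 1) (hN3 : (BetaMap.nobleBetaOfInputs d i).βΨ < 1)
    (hN4 : 0 ≤ (BetaMap.nobleBetaOfInputs d i).αFlow) :
    NobleSimplifiedFormAt d p (BetaMap.nobleBetaOfInputsCorr d i) :=
  nobleSimplifiedFormAt_percolation₅ hd hp hp0 hWF
    (percolationNobleEquationAt_of_summable hd hp hp0 h43.xiAbs.2.1 fun ι => (h43.xiIotaAbs ι).2.1)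
    h43 hN1 hN2 hN3 hN4

/-! ## 2. The two oracle binders from Assumption 4.3, no Prop. 4.5(ii) leaf -/

/-- **The improvement-step oracle binder WITHOUT the Prop. 4.5(ii) hypothesis** (compare
`nobleImprovementInputsAt_of_prop45ii`, whose binder `hfact` this theorem no longer takes).  For `d ≥ 2`, a
well-formed record `i` satisfying (N1′)–(N4), and — at every `p ∈ (p_I, p_c)` at which `f_j(p) ≤ Γ_j` — Assumption
4.3 for the percolation split with constants `i` together with the weighted-diagram bounds `b` ([FvdH17] Prop. 2.2,
STEP 2 of the build): `NobleImprovementInputsAt d cμ c Γ (nobleBetaOfInputsCorr d i) b`.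
[cite: FitznerVanDerHofstad2016NoBLE, Prop. 4.5(ii) (p. 1088); Assumption 4.3 (pp. 1086–1088); App. D (pp. 1110–1117)]
[cite: FitznerVanDerHofstad2017, Prop. 2.1, Prop. 2.2 (EJP pp. 10–11); §2.4–§2.5] -/
theorem nobleImprovementInputsAt_of_assumption43 (hd : 2 ≤ d) {cμ : ℝ} {c : Fin 6 → ℝ} {Γ : Fin 3 → ℝ}
    {i : BetaMap.Inputs} {b : Fin 6 → ℝ} (hWF : NobleInputsWF d i)
    (hN1 : 0 ≤ BetaMap.betaCPhiLow d i.mu i.xiAlphaOneMinusZeroAtZero i.xiIotaAlphaIAtEi)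
    (hN2 : i.xiAbs + i.xiIotaAbs < 1) (hN3 : (BetaMap.nobleBetaOfInputs d i).βΨ < 1)
    (hN4 : 0 ≤ (BetaMap.nobleBetaOfInputs d i).αFlow)
    (hS : ∀ (p : unitInterval) (hp : p ∈ Set.Ioo (nbwThresholdI d) (criticalProbI d)),
      (∀ j, Literature.Barriers.CriticalPhenomena.nobleF d cμ c j p ≤ Γ j) →
        NobleAssumption43At d p (percolationNobleSplit d p hd hp.2) i ∧ NobleWeightedDiagramBoundAt d p b) :
    NobleImprovementInputsAt d cμ c Γ (BetaMap.nobleBetaOfInputsCorr d i) b := by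
  intro p hp hΓ
  obtain ⟨h43, hW⟩ := hS p hp hΓ
  have hp0 : 0 < (p : ℝ) :=
    lt_trans (nbwThresholdI_pos (by omega)) (show (nbwThresholdI d : ℝ) < p by exact_mod_cast hp.1)
  exact ⟨nobleSimplifiedFormAt_percolation₆ hd hp.2 hp0 hWF h43 hN1 hN2 hN3 hN4, hW⟩

/-- **The initial-step oracle binder WITHOUT the Prop. 4.5(ii) hypothesis** (compare
`nobleInitialInputsAt_of_prop45ii`).  At `p_I = 1/(2d−1)` (`0 < p_I < p_c`: `nbwThresholdI_pos`,
`nbwThresholdI_lt_criticalProbI`), Assumption 4.3 for the percolation split with the initial-stage constants `i`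
([NoBLE17] Assumption 4.3, closing sentence: "If Assumption 2.2 holds, then the bounds stated above also holds for
`z = z_I` …", p. 1088) and the weighted-diagram bounds `bi` at `p_I` give `NobleInitialInputsAt d
(nobleBetaOfInputsCorr d i) bi`, for a well-formed `i` satisfying (N1′)–(N4).
[cite: FitznerVanDerHofstad2016NoBLE, Prop. 4.5(ii) (p. 1088); Assumption 4.3, closing sentence (p. 1088); Prop. 2.11 (p. 1061)]
[cite: FitznerVanDerHofstad2017, Prop. 2.2 (EJP p. 11); §2.4–§2.5 (the checks at p_I = 1/(2d−1))] -/
theorem nobleInitialInputsAt_of_assumption43 (hd : 2 ≤ d) {i : BetaMap.Inputs} {bi : Fin 6 → ℝ}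
    (hWF : NobleInputsWF d i)
    (hN1 : 0 ≤ BetaMap.betaCPhiLow d i.mu i.xiAlphaOneMinusZeroAtZero i.xiIotaAlphaIAtEi)
    (hN2 : i.xiAbs + i.xiIotaAbs < 1) (hN3 : (BetaMap.nobleBetaOfInputs d i).βΨ < 1)
    (hN4 : 0 ≤ (BetaMap.nobleBetaOfInputs d i).αFlow)
    (h43 : NobleAssumption43At d (nbwThresholdI d)
      (percolationNobleSplit d (nbwThresholdI d) hd (nbwThresholdI_lt_criticalProbI hd)) i)
    (hW : NobleWeightedDiagramBoundAt d (nbwThresholdI d) bi) :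
    NobleInitialInputsAt d (BetaMap.nobleBetaOfInputsCorr d i) bi :=
  ⟨nobleSimplifiedFormAt_percolation₆ hd (nbwThresholdI_lt_criticalProbI hd) (nbwThresholdI_pos (by omega)) hWF
    h43 hN1 hN2 hN3 hN4, hW⟩

/-! ## 3. Mean-field behaviour from a certificate, no Prop. 4.5(ii) leaf -/

/-- **Mean-field behaviour at dimension `d ≥ 7` from a certified NoBLE bootstrap, App. D in the kernel**
(`meanField_of_certificate` with both oracle binders supplied by §2).  Hypotheses, all typed and visible: a numeric
certificate `P(γ, Γ)` ([NoBLE17] Def. 2.9 / Prop. 2.11 as `NobleNumericCertificate`) for the tables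
`nobleBetaOfInputsCorr d iI`, `nobleBetaOfInputsCorr d iO` and the weighted-diagram bounds `bi`, `bo`; well-formed
records `iI`, `iO` with the sign conditions (N1′)–(N4); Assumption 4.3 with constants `iI` at `p_I` and the
weighted-diagram bounds `bi` there; and, at every `p ∈ (p_I, p_c)` with `f(p) ≤ Γ`, Assumption 4.3 with constants
`iO` and the weighted-diagram bounds `bo`.  Conclusion: the triangle condition, `θ(p_c) = 0`, `β = 1`
(bounded-ratio sense) in dimension `d`.  NO Prop. 4.5(ii) / App. D hypothesis.
[cite: FitznerVanDerHofstad2016NoBLE, Thm 2.10, Prop. 2.11, Def. 2.9 (pp. 1060–1062); Prop. 4.5(ii) (p. 1088); App. D (pp. 1110–1117)]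
[cite: FitznerVanDerHofstad2017, Thm 1.1 and Cor. 1.3; Prop. 2.1, Prop. 2.2 (EJP pp. 10–11)] -/
theorem meanField_of_certificate_assumption43 (hd : 7 ≤ d)
    {cμ : ℝ} {c : Fin 6 → ℝ} {γ Γ : Fin 3 → ℝ} {iI iO : BetaMap.Inputs} {bi bo : Fin 6 → ℝ}
    (hN : NobleNumericCertificate d cμ c γ Γ (BetaMap.nobleBetaOfInputsCorr d iI)
      (BetaMap.nobleBetaOfInputsCorr d iO) bi bo)
    (hWFI : NobleInputsWF d iI)
    (hI1 : 0 ≤ BetaMap.betaCPhiLow d iI.mu iI.xiAlphaOneMinusZeroAtZero iI.xiIotaAlphaIAtEi)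
    (hI2 : iI.xiAbs + iI.xiIotaAbs < 1) (hI3 : (BetaMap.nobleBetaOfInputs d iI).βΨ < 1)
    (hI4 : 0 ≤ (BetaMap.nobleBetaOfInputs d iI).αFlow)
    (hWFO : NobleInputsWF d iO)
    (hO1 : 0 ≤ BetaMap.betaCPhiLow d iO.mu iO.xiAlphaOneMinusZeroAtZero iO.xiIotaAlphaIAtEi)
    (hO2 : iO.xiAbs + iO.xiIotaAbs < 1) (hO3 : (BetaMap.nobleBetaOfInputs d iO).βΨ < 1)
    (hO4 : 0 ≤ (BetaMap.nobleBetaOfInputs d iO).αFlow)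
    (hI43 : NobleAssumption43At d (nbwThresholdI d)
      (percolationNobleSplit d (nbwThresholdI d) (by omega) (nbwThresholdI_lt_criticalProbI (by omega))) iI)
    (hIW : NobleWeightedDiagramBoundAt d (nbwThresholdI d) bi)
    (hS : ∀ (p : unitInterval) (hp : p ∈ Set.Ioo (nbwThresholdI d) (criticalProbI d)),
      (∀ j, Literature.Barriers.CriticalPhenomena.nobleF d cμ c j p ≤ Γ j) →
        NobleAssumption43At d p (percolationNobleSplit d p (by omega) hp.2) iO ∧
          NobleWeightedDiagramBoundAt d p bo) :
    TriangleCondition d ∧ PercolationContinuity d ∧ BetaEqOneBoundedRatio d :=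
  meanField_of_certificate hd hN
    (nobleInitialInputsAt_of_assumption43 (by omega) hWFI hI1 hI2 hI3 hI4 hI43 hIW)
    (nobleImprovementInputsAt_of_assumption43 (by omega) hWFO hO1 hO2 hO3 hO4 hS)

end Literature.Probability.FitznerVanDerHofstad2017

end
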